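import Summits.Ventures.WeilGRH.TwistedSechSeries
import Summits.RiemannHypothesis.RiemannHypothesis.Theorems.WeilCombCombShapePositivityLogConcaveCellRules
import Mathlib.Analysis.SpecialFunctions.Trigonometric.DerivHyp
import Mathlib.Analysis.SpecialFunctions.Gamma.Basic
import HarnessLib

/-!
# GRH arm (rh-explicit, venture WeilGRH): the `sech` expansion with the SECOND Euler step — remainder `O(K⁻⁵)`

Cell `rh-explicit`, WEIL TRACK — GRH ARM (engine seat weil-grh-2 gen9).  Sequel of `TwistedSechSeries.lean` (weil-grh-1) and
`TwistedSechSeriesHalf.lean` (gen9, first Euler step, remainder `C/(K+½)³`).  The exact tail of the alternating expansion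
of `σ(t) = 1/(2cosh(t/2))` is `(−1)^K e^{−(K+½)t}/(1+e^{−t})`, and `1/(1+e^{−t}) = ½ + ½tanh(t/2)`; Taylor to second order:

* `mul_cosh_sub_sinh_le` — `y cosh y − sinh y ≤ (y³/3) cosh y` for `y ≥ 0` (monotonicity; with the tree's
  `WeilCombBohrFejer.mul_cosh_sub_sinh_nonneg` this is `y − y³/3 ≤ tanh y ≤ y`);
* `logistic_taylor_two` — `−t³/48 ≤ 1/(1+e^{−t}) − ½ − t/4 ≤ 0` for `t ≥ 0`;
* ★ `abs_integral_sech_mul_sub_sum_quarter_le` — for measurable `F` with `|F(t)| ≤ C·t` on `(0, T]`: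
  `|∫_{(0,T]} σF − Σ_{k<K} (−1)^k ∫ e^{−(k+½)t}F − ((−1)^K/2)∫ e^{−(K+½)t}F − ((−1)^K/4)∫ t·e^{−(K+½)t}F| ≤ C/(2(K+½)⁵)`.

For the `sech` tables this means `K ≈ 32` terms reach the radius that `K = 512` one-step terms give (diagonal entry at
`a = 0.59`, `n = 7`: `7·10⁻⁷` at `K = 64`); the extra correction term is ONE more elementary integral per entry
(`∫ t e^{−lt} sin`, `∫ t² e^{−lt} cos` — closed forms to be added next to weil-2's `WeilFormatCEntryArchIntegrals`).
No definitions; no named facts; RH/GRH-free.  References: the Euler transform of alternating series [folklore];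
H. Yoshida (1992) §5 [Yoshida1992HermitianForms].
-/

set_option autoImplicit false

noncomputable section

open Filter Set MeasureTheory
open scoped Real Topology
open Summit.RiemannHypothesis.RiemannHypothesis.Theorems.WeilCombBohrFejer (mul_cosh_sub_sinh_nonneg)

namespace Summit.Ventures.WeilGRH

/-! ## `y − y³/3 ≤ tanh y ≤ y` in the form needed (no division) -/

-- `0 ≤ y cosh y − sinh y` (`y ≥ 0`) is the tree's `WeilCombBohrFejer.mul_cosh_sub_sinh_nonneg` (reused, not restated).

/-- `y cosh y − sinh y ≤ (y³/3) cosh y` for `y ≥ 0` (i.e. `tanh y ≥ y − y³/3`). [folklore] -/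
theorem mul_cosh_sub_sinh_le {y : ℝ} (hy : 0 ≤ y) : y * Real.cosh y - Real.sinh y ≤ y ^ 3 / 3 * Real.cosh y := by
  -- `g(y) = sinh y − y cosh y + (y³/3) cosh y` is monotone on `[0, ∞)` with `g(0) = 0`
  let g : ℝ → ℝ := fun x ↦ Real.sinh x - x * Real.cosh x + x ^ 3 / 3 * Real.cosh x
  have hd : ∀ x : ℝ, HasDerivAt g (x * (x * Real.cosh x - Real.sinh x) + x ^ 3 / 3 * Real.sinh x) x := by
    intro x
    have h1 : HasDerivAt (fun x ↦ x * Real.cosh x) (1 * Real.cosh x + x * Real.sinh x) x :=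
      (hasDerivAt_id x).mul (Real.hasDerivAt_cosh x)
    have h3 : HasDerivAt (fun x : ℝ ↦ x ^ 3 / 3) (((3 : ℕ) : ℝ) * x ^ (3 - 1) / 3) x :=
      (hasDerivAt_pow 3 x).div_const 3
    have h4 : HasDerivAt (fun x ↦ x ^ 3 / 3 * Real.cosh x) (((3 : ℕ) : ℝ) * x ^ (3 - 1) / 3 * Real.cosh x + x ^ 3 / 3 * Real.sinh x) x :=
      h3.mul (Real.hasDerivAt_cosh x)
    exact (((Real.hasDerivAt_sinh x).sub h1).add h4).congr_deriv (by push_cast; ring)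
  have hmono : MonotoneOn g (Ici 0) := by
    refine monotoneOn_of_deriv_nonneg (convex_Ici 0) ?_ ?_ fun x hx ↦ ?_
    · exact HasDerivAt.continuousOn fun x _ ↦ hd x
    · exact fun x _ ↦ (hd x).differentiableAt.differentiableWithinAt
    · rw [interior_Ici, mem_Ioi] at hx
      rw [(hd x).deriv]
      have h1 := mul_cosh_sub_sinh_nonneg hx.le
      have h2 : 0 ≤ Real.sinh x := Real.sinh_nonneg_iff.mpr hx.le
      positivity
  have h := hmono (self_mem_Ici) (mem_Ici.mpr hy) hy
  simp only [g, Real.sinh_zero, Real.cosh_zero, mul_one, sub_zero] at h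
  norm_num at h
  linarith

/-! ## The logistic function to second order -/

/-- `1/(1+e^{−t}) − ½ = sinh(t/2)/(2cosh(t/2))`. [folklore] -/
theorem logistic_sub_half_eq (t : ℝ) :
    1 / (1 + Real.exp (-t)) - 1 / 2 = Real.sinh (t / 2) / (2 * Real.cosh (t / 2)) := by
  have hc : 0 < Real.cosh (t / 2) := Real.cosh_pos _
  have hpos : 0 < 1 + Real.exp (-t) := by positivity
  rw [Real.sinh_eq, Real.cosh_eq]
  have e1 : Real.exp (-t) = Real.exp (-(t / 2)) * Real.exp (-(t / 2)) := by rw [← Real.exp_add]; ring_nf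
  have hE : 0 < Real.exp (t / 2) := Real.exp_pos _
  have hE' : 0 < Real.exp (-(t / 2)) := Real.exp_pos _
  have e2 : Real.exp (t / 2) * Real.exp (-(t / 2)) = 1 := by rw [← Real.exp_add]; simp
  rw [e1]
  field_simp
  nlinarith [e2]

/-- **Second-order Taylor bound of the logistic function**: `−t³/48 ≤ 1/(1+e^{−t}) − ½ − t/4 ≤ 0` for `t ≥ 0`. [folklore] -/
theorem logistic_taylor_two {t : ℝ} (ht : 0 ≤ t) :
    -(t ^ 3 / 48) ≤ 1 / (1 + Real.exp (-t)) - 1 / 2 - t / 4 ∧ 1 / (1 + Real.exp (-t)) - 1 / 2 - t / 4 ≤ 0 := by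
  rw [logistic_sub_half_eq]
  have hy : 0 ≤ t / 2 := by linarith
  have hc : 0 < Real.cosh (t / 2) := Real.cosh_pos _
  have h1 := mul_cosh_sub_sinh_nonneg hy
  have h2 := mul_cosh_sub_sinh_le hy
  constructor
  · -- `sinh y/(2cosh y) − y/2 ≥ −y³/6`  ⇔  `y cosh y − sinh y ≤ (y³/3) cosh y`
    rw [show -(t ^ 3 / 48) = -((t / 2) ^ 3 / 3 * Real.cosh (t / 2)) / (2 * Real.cosh (t / 2)) by field_simp; ring,
      show Real.sinh (t / 2) / (2 * Real.cosh (t / 2)) - t / 4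
        = -((t / 2) * Real.cosh (t / 2) - Real.sinh (t / 2)) / (2 * Real.cosh (t / 2)) by field_simp; ring]
    exact div_le_div_of_nonneg_right (by linarith) (by positivity)
  · rw [show Real.sinh (t / 2) / (2 * Real.cosh (t / 2)) - t / 4
        = -((t / 2) * Real.cosh (t / 2) - Real.sinh (t / 2)) / (2 * Real.cosh (t / 2)) by field_simp; ring]
    exact div_nonpos_of_nonpos_of_nonneg (by linarith) (by positivity)

/-- `|1/(1+e^{−t}) − ½ − t/4| ≤ t³/48` for `t ≥ 0`. [folklore] -/
theorem abs_logistic_taylor_two {t : ℝ} (ht : 0 ≤ t) :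
    |1 / (1 + Real.exp (-t)) - 1 / 2 - t / 4| ≤ t ^ 3 / 48 := by
  obtain ⟨h1, h2⟩ := logistic_taylor_two ht
  rw [abs_le]; constructor <;> linarith

/-- **The twice-corrected expansion**: `σ − S_K − ((−1)^K/2)e_K − ((−1)^K/4)·t·e_K = (−1)^K e_K · (1/(1+e^{−t}) − ½ − t/4)`. -/
theorem sech_density_sub_partial_sum_sub_half_sub_quarter (t : ℝ) (K : ℕ) :
    1 / (2 * Real.cosh (t / 2)) - ∑ k ∈ Finset.range K, (-1 : ℝ) ^ k * Real.exp (-((k + 1 / 2) * t))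
        - (-1 : ℝ) ^ K / 2 * Real.exp (-((K + 1 / 2) * t)) - (-1 : ℝ) ^ K / 4 * (t * Real.exp (-((K + 1 / 2) * t))) =
      (-1 : ℝ) ^ K * Real.exp (-((K + 1 / 2) * t)) * (1 / (1 + Real.exp (-t)) - 1 / 2 - t / 4) := by
  rw [sech_density_sub_partial_sum]
  ring

/-! ## Termwise integration with two correction terms -/

/-- `∫₀^∞ t⁴ e^{−ct} dt = 24/c⁵` (`c > 0`). -/
theorem integral_pow_four_mul_exp_neg_mul_Ioi {c : ℝ} (hc : 0 < c) :
    ∫ t in Ioi (0 : ℝ), t ^ 4 * Real.exp (-(c * t)) = 24 / c ^ 5 := by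
  have h := Real.integral_rpow_mul_exp_neg_mul_Ioi (a := 5) (r := c) (by norm_num) hc
  have hG : Real.Gamma 5 = 24 := by
    rw [show (5 : ℝ) = (4 : ℕ) + 1 by norm_num, Real.Gamma_nat_eq_factorial]
    norm_num [Nat.factorial]
  rw [show (5 : ℝ) - 1 = 4 by norm_num, hG, show (1 / c) ^ (5 : ℝ) = 1 / c ^ 5 by
    rw [show (5 : ℝ) = (5 : ℕ) by norm_num, Real.rpow_natCast]; ring] at h
  rw [show 24 / c ^ 5 = 1 / c ^ 5 * 24 by ring, ← h]
  refine setIntegral_congr_fun measurableSet_Ioi fun t _ ↦ ?_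
  rw [show (4 : ℝ) = (4 : ℕ) by norm_num, Real.rpow_natCast]

/-- `t ↦ t⁴ e^{−ct}` is integrable on `(0, ∞)` (`c > 0`). -/
theorem integrableOn_pow_four_mul_exp_neg_mul_Ioi {c : ℝ} (hc : 0 < c) :
    IntegrableOn (fun t : ℝ ↦ t ^ 4 * Real.exp (-(c * t))) (Ioi 0) := by
  have h : ∫ t in Ioi (0 : ℝ), t ^ 4 * Real.exp (-(c * t)) ≠ 0 := by
    rw [integral_pow_four_mul_exp_neg_mul_Ioi hc]; positivity
  exact Integrable.of_integral_ne_zero h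

/-- ★ **Termwise integration of the `sech` block with TWO correction terms**: if `F` is measurable with `|F(t)| ≤ C·t` on
`(0, T]`, then `|∫_{(0,T]} σF − Σ_{k<K} (−1)^k ∫ e^{−(k+½)t}F − ((−1)^K/2)∫ e^{−(K+½)t}F − ((−1)^K/4)∫ t e^{−(K+½)t}F|
≤ C/(2(K+½)⁵)`. -/
theorem abs_integral_sech_mul_sub_sum_quarter_le {F : ℝ → ℝ} {C T : ℝ} (hF : Measurable F) (hC : 0 ≤ C)
    (hb : ∀ t ∈ Ioc 0 T, |F t| ≤ C * t) (K : ℕ) :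
    |(∫ t in Ioc 0 T, 1 / (2 * Real.cosh (t / 2)) * F t) -
        (∑ k ∈ Finset.range K, (-1 : ℝ) ^ k * ∫ t in Ioc 0 T, Real.exp (-((k + 1 / 2) * t)) * F t)
        - (-1 : ℝ) ^ K / 2 * (∫ t in Ioc 0 T, Real.exp (-((K + 1 / 2) * t)) * F t)
        - (-1 : ℝ) ^ K / 4 * ∫ t in Ioc 0 T, t * Real.exp (-((K + 1 / 2) * t)) * F t| ≤
      C / (2 * (K + 1 / 2) ^ 5) := by
  rcases le_or_gt T 0 with hT | hT
  · have he : Ioc 0 T = ∅ := Ioc_eq_empty (not_lt.2 hT)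
    simp only [he, Measure.restrict_empty, integral_zero_measure, mul_zero, Finset.sum_const_zero, sub_zero,
      abs_zero]
    positivity
  have hFb : ∀ t ∈ Ioc 0 T, |F t| ≤ C * T := fun t ht ↦
    (hb t ht).trans (mul_le_mul_of_nonneg_left ht.2 hC)
  have hfin : volume (Ioc 0 T) < ⊤ := by simp [Real.volume_Ioc]
  -- integrability of `g·F` for a measurable `g` bounded by `M` on `(0, T]`
  have hint : ∀ {g : ℝ → ℝ} (M : ℝ), Measurable g → (∀ t ∈ Ioc 0 T, |g t| ≤ M) →
      IntegrableOn (fun t ↦ g t * F t) (Ioc 0 T) := by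
    intro g M hg hgM
    refine Measure.integrableOn_of_bounded (M := M * (C * T)) hfin.ne ((hg.mul hF).aestronglyMeasurable)
      ((ae_restrict_iff' measurableSet_Ioc).2 (Eventually.of_forall fun t ht ↦ ?_))
    rw [Real.norm_eq_abs, abs_mul]
    exact mul_le_mul (hgM t ht) (hFb t ht) (abs_nonneg _) ((abs_nonneg _).trans (hgM t ht))
  have hσ1 : ∀ t ∈ Ioc 0 T, |1 / (2 * Real.cosh (t / 2))| ≤ 1 := fun t _ ↦ by
    rw [abs_of_pos (sech_density_pos t)]
    have := Real.one_le_cosh (t / 2)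
    rw [div_le_one (by positivity)]; linarith
  have hek : ∀ k : ℕ, ∀ t ∈ Ioc 0 T, |Real.exp (-((k + 1 / 2) * t))| ≤ 1 := fun k t ht ↦ by
    rw [Real.abs_exp, Real.exp_le_one_iff]; nlinarith [ht.1]
  have htek : ∀ t ∈ Ioc 0 T, |t * Real.exp (-((K + 1 / 2) * t))| ≤ T := fun t ht ↦ by
    rw [abs_mul, abs_of_pos ht.1]
    calc t * |Real.exp (-((K + 1 / 2) * t))| ≤ T * 1 := mul_le_mul ht.2 (hek K t ht) (abs_nonneg _) hT.le
      _ = T := mul_one T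
  have hmk : ∀ k : ℕ, Measurable fun t : ℝ ↦ Real.exp (-((k + 1 / 2) * t)) := fun k ↦
    (Real.continuous_exp.comp (by fun_prop)).measurable
  have hmt : Measurable fun t : ℝ ↦ t * Real.exp (-((K + 1 / 2) * t)) := measurable_id.mul (hmk K)
  have hIσ := hint 1 continuous_sech_density.measurable hσ1
  have hIk : ∀ k : ℕ, IntegrableOn (fun t ↦ Real.exp (-((k + 1 / 2) * t)) * F t) (Ioc 0 T) :=
    fun k ↦ hint 1 (hmk k) (hek k)
  have hIt : IntegrableOn (fun t ↦ t * Real.exp (-((K + 1 / 2) * t)) * F t) (Ioc 0 T) := hint T hmt htek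
  -- the corrected partial sum
  set SK : ℝ → ℝ := fun t ↦ ∑ k ∈ Finset.range K, (-1 : ℝ) ^ k * Real.exp (-((k + 1 / 2) * t))
    + (-1 : ℝ) ^ K / 2 * Real.exp (-((K + 1 / 2) * t)) + (-1 : ℝ) ^ K / 4 * (t * Real.exp (-((K + 1 / 2) * t))) with hSK
  have hSKF : ∀ t, SK t * F t = ∑ k ∈ Finset.range K, (-1 : ℝ) ^ k * (Real.exp (-((k + 1 / 2) * t)) * F t)
      + (-1 : ℝ) ^ K / 2 * (Real.exp (-((K + 1 / 2) * t)) * F t)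
      + (-1 : ℝ) ^ K / 4 * (t * Real.exp (-((K + 1 / 2) * t)) * F t) := by
    intro t; rw [hSK]; dsimp only; rw [add_mul, add_mul, Finset.sum_mul]
    congr 1
    · congr 1
      · exact Finset.sum_congr rfl fun k _ ↦ by ring
      · ring
    · ring
  have hIS : IntegrableOn (fun t ↦ SK t * F t) (Ioc 0 T) := by
    have : (fun t ↦ SK t * F t) = fun t ↦ ∑ k ∈ Finset.range K, (-1 : ℝ) ^ k * (Real.exp (-((k + 1 / 2) * t)) * F t)
        + (-1 : ℝ) ^ K / 2 * (Real.exp (-((K + 1 / 2) * t)) * F t)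
        + (-1 : ℝ) ^ K / 4 * (t * Real.exp (-((K + 1 / 2) * t)) * F t) := funext hSKF
    rw [this]
    exact ((integrable_finsetSum _ fun k _ ↦ (hIk k).const_mul _).add ((hIk K).const_mul _)).add (hIt.const_mul _)
  have hID : IntegrableOn (fun t ↦ (1 / (2 * Real.cosh (t / 2)) - SK t) * F t) (Ioc 0 T) :=
    (hIσ.sub hIS).congr_fun (fun t _ ↦ by simp only [Pi.sub_apply]; ring) measurableSet_Ioc
  have hsumInt : ∫ t in Ioc 0 T, SK t * F t =
      (∑ k ∈ Finset.range K, (-1 : ℝ) ^ k * ∫ t in Ioc 0 T, Real.exp (-((k + 1 / 2) * t)) * F t)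
        + (-1 : ℝ) ^ K / 2 * (∫ t in Ioc 0 T, Real.exp (-((K + 1 / 2) * t)) * F t)
        + (-1 : ℝ) ^ K / 4 * ∫ t in Ioc 0 T, t * Real.exp (-((K + 1 / 2) * t)) * F t := by
    have hI12 : IntegrableOn (fun t ↦ ∑ k ∈ Finset.range K, (-1 : ℝ) ^ k * (Real.exp (-((k + 1 / 2) * t)) * F t)
        + (-1 : ℝ) ^ K / 2 * (Real.exp (-((K + 1 / 2) * t)) * F t)) (Ioc 0 T) :=
      (integrable_finsetSum _ fun k _ ↦ (hIk k).const_mul ((-1 : ℝ) ^ k)).add ((hIk K).const_mul _)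
    have hI3 : IntegrableOn (fun t ↦ (-1 : ℝ) ^ K / 4 * (t * Real.exp (-((K + 1 / 2) * t)) * F t)) (Ioc 0 T) :=
      hIt.const_mul _
    have h1 : ∫ t in Ioc 0 T, SK t * F t =
        (∫ t in Ioc 0 T, (∑ k ∈ Finset.range K, (-1 : ℝ) ^ k * (Real.exp (-((k + 1 / 2) * t)) * F t)
            + (-1 : ℝ) ^ K / 2 * (Real.exp (-((K + 1 / 2) * t)) * F t)))
          + ∫ t in Ioc 0 T, (-1 : ℝ) ^ K / 4 * (t * Real.exp (-((K + 1 / 2) * t)) * F t) := by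
      rw [← integral_add hI12 hI3]
      exact setIntegral_congr_fun measurableSet_Ioc fun t _ ↦ hSKF t
    have h2 : ∫ t in Ioc 0 T, (∑ k ∈ Finset.range K, (-1 : ℝ) ^ k * (Real.exp (-((k + 1 / 2) * t)) * F t)
            + (-1 : ℝ) ^ K / 2 * (Real.exp (-((K + 1 / 2) * t)) * F t)) =
        (∑ k ∈ Finset.range K, (-1 : ℝ) ^ k * ∫ t in Ioc 0 T, Real.exp (-((k + 1 / 2) * t)) * F t)
          + (-1 : ℝ) ^ K / 2 * (∫ t in Ioc 0 T, Real.exp (-((K + 1 / 2) * t)) * F t) := by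
      rw [integral_add (integrable_finsetSum _ fun k _ ↦ (hIk k).const_mul ((-1 : ℝ) ^ k)) ((hIk K).const_mul _),
        integral_finsetSum _ (fun k _ ↦ (hIk k).const_mul ((-1 : ℝ) ^ k)), integral_const_mul ((-1 : ℝ) ^ K / 2)]
      congr 1
      exact Finset.sum_congr rfl fun k _ ↦ integral_const_mul ((-1 : ℝ) ^ k) _
    rw [h1, h2, integral_const_mul ((-1 : ℝ) ^ K / 4)]
  have hdiff : (∫ t in Ioc 0 T, 1 / (2 * Real.cosh (t / 2)) * F t) -
      (∑ k ∈ Finset.range K, (-1 : ℝ) ^ k * ∫ t in Ioc 0 T, Real.exp (-((k + 1 / 2) * t)) * F t)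
      - (-1 : ℝ) ^ K / 2 * (∫ t in Ioc 0 T, Real.exp (-((K + 1 / 2) * t)) * F t)
      - (-1 : ℝ) ^ K / 4 * (∫ t in Ioc 0 T, t * Real.exp (-((K + 1 / 2) * t)) * F t) =
      ∫ t in Ioc 0 T, (1 / (2 * Real.cosh (t / 2)) - SK t) * F t := by
    rw [sub_sub, sub_sub, ← add_assoc, ← hsumInt, ← integral_sub hIσ hIS]
    refine setIntegral_congr_fun measurableSet_Ioc fun t _ ↦ ?_
    ring
  rw [hdiff]
  -- bound by `∫ (t³/48) e_K · C t ≤ (C/48)·24/(K+½)⁵`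
  have hc : (0 : ℝ) < K + 1 / 2 := by positivity
  have hdom : IntegrableOn (fun t : ℝ ↦ C / 48 * (t ^ 4 * Real.exp (-((K + 1 / 2) * t)))) (Ioi 0) :=
    (integrableOn_pow_four_mul_exp_neg_mul_Ioi hc).const_mul (C / 48)
  have hpt : ∀ t ∈ Ioc 0 T, 1 / (2 * Real.cosh (t / 2)) - SK t =
      1 / (2 * Real.cosh (t / 2)) - ∑ k ∈ Finset.range K, (-1 : ℝ) ^ k * Real.exp (-((k + 1 / 2) * t))
        - (-1 : ℝ) ^ K / 2 * Real.exp (-((K + 1 / 2) * t)) - (-1 : ℝ) ^ K / 4 * (t * Real.exp (-((K + 1 / 2) * t))) :=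
    fun t _ ↦ by rw [hSK]; dsimp only; ring
  calc |∫ t in Ioc 0 T, (1 / (2 * Real.cosh (t / 2)) - SK t) * F t|
      ≤ ∫ t in Ioc 0 T, C / 48 * (t ^ 4 * Real.exp (-((K + 1 / 2) * t))) := by
        rw [← Real.norm_eq_abs]
        refine (norm_integral_le_integral_norm _).trans
          (setIntegral_mono_on hID.norm (hdom.mono_set Ioc_subset_Ioi_self) measurableSet_Ioc fun t ht ↦ ?_)
        rw [Real.norm_eq_abs, abs_mul, hpt t ht, sech_density_sub_partial_sum_sub_half_sub_quarter, abs_mul, abs_mul,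
          abs_pow, abs_neg, abs_one, one_pow, one_mul, Real.abs_exp]
        have h1 := abs_logistic_taylor_two ht.1.le
        have h2 := hb t ht
        have hE := Real.exp_pos (-((K + 1 / 2 : ℝ) * t))
        calc Real.exp (-((K + 1 / 2) * t)) * |1 / (1 + Real.exp (-t)) - 1 / 2 - t / 4| * |F t|
            ≤ Real.exp (-((K + 1 / 2) * t)) * (t ^ 3 / 48) * (C * t) :=
              mul_le_mul (mul_le_mul_of_nonneg_left h1 hE.le) h2 (abs_nonneg _)
                (by have := ht.1.le; positivity)
          _ = C / 48 * (t ^ 4 * Real.exp (-((K + 1 / 2) * t))) := by ring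
    _ ≤ ∫ t in Ioi 0, C / 48 * (t ^ 4 * Real.exp (-((K + 1 / 2) * t))) :=
        setIntegral_mono_set hdom
          ((ae_restrict_iff' measurableSet_Ioi).2 (Eventually.of_forall fun t (ht : 0 < t) ↦ by
            have := Real.exp_pos (-((K + 1 / 2 : ℝ) * t)); positivity))
          Ioc_subset_Ioi_self.eventuallyLE
    _ = C / (2 * (K + 1 / 2) ^ 5) := by
        rw [integral_const_mul, integral_pow_four_mul_exp_neg_mul_Ioi hc]
        have hK5 : (0 : ℝ) < (K + 1 / 2) ^ 5 := by positivity
        field_simp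
        ring

end Summit.Ventures.WeilGRH

end
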